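import Mathlib
import HarnessLib

/-!
# PCINT lane, king route, K1 step (5): adaptive stochastic domination WITHOUT couplings (finite version)

Cell `prim-pcint`, seat `prim-pcint-1` (gen 9); memo `run/shared/lean/prim/pcint/KING-ROUTE.md` §K1.

The "standard argument" behind Menshikov–Pelikh / van den Berg–Ermakov (Random Struct. Alg. 8 (1996),
§3: *"using Theorem 1.3 [Strassen] for each step … and standard arguments, we can construct a coupling"*),
in a form that needs neither Strassen's theorem nor any coupling, only finite sums:

**Setting.**  `V` a finite set of sites; `q ∈ [0, 1]`; the reference law is the product Bernoulli law
`π_q` on `V → Bool` (weights `wt q ω = ∏_v bern q (ω v)`).  An *exploration rule* `R` maps a partial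
assignment `σ : V → Option Bool` (the sites revealed so far, with their values) to the finite set `R σ` of
sites examined next (required unrevealed).  Process 1 reveals the true values of a `π_q`-sample; process 2
is ANY finite probability space `(Ω, μ)` with an outcome oracle `out : Ω → (V → Option Bool) → (V → Bool)`
(the values it reports when the current state is `σ`), run with the same rule: `run R (out w) n`.

**Theorem (`AdaptDom.expect_le_of_dominating`).**  Let `F : (V → Bool) → ℝ` be monotone.  If at every
step the conditional law of the reported values dominates `π_q` on the examined sites — for every state
`σ` and every test function `g` that is monotone and depends only on the sites of `R σ`,
`Σ_{w : run_n(w) = σ} μ(w) g(out w σ) ≥ μ(run_n = σ) · E_{π_q}[g]` — and if after `N` steps the value of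
`F` is determined by the revealed sites, then

  `E_{π_q}[F] ≤ Σ_w μ(w) · F(final state of w, completed arbitrarily)`.

Proof: the `π_q`-continuation value `cval σ = E_{π_q}[F(merge σ ·)]` satisfies the tower identity
`cval σ = E_{π_q}[cval (step σ ·)]` (an involution on pairs of configurations swapping the examined
coordinates, `sum_sum_mix`), is monotone in the examined values (because `F` is), hence
`n ↦ Σ_w μ(w) cval(run_n(w))` is non-decreasing; at `n = 0` it is `E_{π_q}[F]`, at `n = N` the payoff.

Use: with `F = 𝟙{o ⟷ ∂B(n) by open sites of ℤ²}` and process 2 = the `ξ`-exploration of van den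
Berg–Ermakov driven by the pair states `ε` of `ℤ²∗`, this turns the 48 local dominance inequalities into
`P_q^{ℤ²}(o ⟷ ∂B(n)) ≤ P_p^{ℤ²∗-pairs}(o ⟷ ∂B(n))` (K1 steps (1)–(4), to come).
-/

namespace Summit.CriticalPhenomena.PercolationContinuityZ3.Theorems.Pcint

namespace AdaptDom

open Finset

variable {V : Type*} [Fintype V] [DecidableEq V]

/-! ### Product Bernoulli weights on `V → Bool` -/

/-- The Bernoulli weight of one bit: `q` for `true`, `1 - q` for `false`. -/
def bern (q : ℝ) (b : Bool) : ℝ := if b then q else 1 - q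

/-- The product weight `π_q(ω) = ∏_v bern q (ω v)`. -/
def wt (q : ℝ) (ω : V → Bool) : ℝ := ∏ v, bern q (ω v)

/-- `bern q b ≥ 0` for `q ∈ [0, 1]`. -/
theorem bern_nonneg {q : ℝ} (hq0 : 0 ≤ q) (hq1 : q ≤ 1) (b : Bool) : 0 ≤ bern q b := by
  unfold bern; split_ifs <;> linarith

omit [DecidableEq V] in
/-- `π_q(ω) ≥ 0` for `q ∈ [0, 1]`. -/
theorem wt_nonneg {q : ℝ} (hq0 : 0 ≤ q) (hq1 : q ≤ 1) (ω : V → Bool) : 0 ≤ wt q ω :=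
  Finset.prod_nonneg fun v _ => bern_nonneg hq0 hq1 (ω v)

/-- The two Bernoulli weights sum to `1`. -/
theorem sum_bern (q : ℝ) : ∑ b : Bool, bern q b = 1 := by
  rw [Fintype.sum_bool]; simp [bern]

/-- `π_q` is a probability: `Σ_ω π_q(ω) = 1`. -/
theorem sum_wt (q : ℝ) : ∑ ω : V → Bool, wt q ω = 1 := by
  unfold wt
  rw [← Fintype.piFinset_univ, ← Finset.prod_univ_sum]
  simp only [sum_bern, Finset.prod_const_one]

/-! ### Mixing two configurations on a set of sites -/

/-- `mix S ω ω'`: the configuration equal to `ω` on `S` and to `ω'` off `S`. -/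
def mix (S : Finset V) (ω ω' : V → Bool) : V → Bool := fun v => if v ∈ S then ω v else ω' v

/-- Swapping the `S`-coordinates of a pair of configurations. -/
def swapOn (S : Finset V) (z : (V → Bool) × (V → Bool)) : (V → Bool) × (V → Bool) :=
  (mix S z.1 z.2, mix S z.2 z.1)

omit [Fintype V] in
/-- Swapping twice is the identity. -/
theorem swapOn_involutive (S : Finset V) : Function.Involutive (swapOn (V := V) S) := by
  intro z
  obtain ⟨ω, ω'⟩ := z
  simp only [swapOn, Prod.mk.injEq]
  constructor <;> (funext v; unfold mix; split_ifs <;> rfl)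

/-- Swapping coordinates preserves the product of the two weights. -/
theorem wt_mix_mul_wt_mix (q : ℝ) (S : Finset V) (ω ω' : V → Bool) :
    wt q (mix S ω ω') * wt q (mix S ω' ω) = wt q ω * wt q ω' := by
  unfold wt
  rw [← Finset.prod_mul_distrib, ← Finset.prod_mul_distrib]
  refine Finset.prod_congr rfl fun v _ => ?_
  unfold mix
  split_ifs
  · rfl
  · exact mul_comm _ _

/-- **Integrating out the mixed-in coordinates**: `Σ_ω Σ_ω' π(ω) π(ω') G(mix S ω ω') = Σ_ω π(ω) G(ω)`. -/
theorem sum_sum_mix (q : ℝ) (S : Finset V) (G : (V → Bool) → ℝ) :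
    ∑ ω : V → Bool, ∑ ω' : V → Bool, wt q ω * wt q ω' * G (mix S ω ω') =
      ∑ ω : V → Bool, wt q ω * G ω := by
  have h1 : ∑ ω : V → Bool, ∑ ω' : V → Bool, wt q ω * wt q ω' * G (mix S ω ω') =
      ∑ z : (V → Bool) × (V → Bool), wt q z.1 * wt q z.2 * G (mix S z.1 z.2) := by
    rw [Fintype.sum_prod_type]
  have h2 : ∑ ω : V → Bool, wt q ω * G ω =
      ∑ z : (V → Bool) × (V → Bool), wt q z.1 * wt q z.2 * G z.1 := by
    rw [Fintype.sum_prod_type]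
    refine Finset.sum_congr rfl fun ω _ => ?_
    simp_rw [mul_right_comm (wt q ω) _ (G ω)]
    rw [← Finset.mul_sum, sum_wt, mul_one]
  rw [h1, h2]
  -- reindex by the involution `swapOn S`
  refine Fintype.sum_equiv ((swapOn_involutive S).toPerm _) _ _ fun z => ?_
  obtain ⟨ω, ω'⟩ := z
  change wt q ω * wt q ω' * G (mix S ω ω') = wt q (mix S ω ω') * wt q (mix S ω' ω) * G (mix S ω ω')
  rw [wt_mix_mul_wt_mix]

/-! ### Partial assignments, exploration rules, continuation values -/

/-- Completing a partial assignment `σ` by a configuration `ω` on the unrevealed sites. -/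
def merge (σ : V → Option Bool) (ω : V → Bool) : V → Bool := fun v => (σ v).getD (ω v)

/-- One exploration step: reveal, on the sites of `S`, the values reported by `x`. -/
def stepPA (S : Finset V) (σ : V → Option Bool) (x : V → Bool) : V → Option Bool :=
  fun v => if v ∈ S then some (x v) else σ v

/-- Running an exploration rule `R` for `n` steps with the outcome oracle `x` (values reported as a
function of the current state), from the empty state. -/
def run (R : (V → Option Bool) → Finset V) (x : (V → Option Bool) → V → Bool) : ℕ → V → Option Bool
  | 0 => fun _ => none
  | n + 1 => stepPA (R (run R x n)) (run R x n) (x (run R x n))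

/-- The `π_q`-continuation value of the payoff `F` from the state `σ`: `E_{π_q}[F(merge σ ·)]`
(`= E_{π_q}[F | the revealed values]`, the revealed coordinates integrating to `1`). -/
def cval (q : ℝ) (F : (V → Bool) → ℝ) (σ : V → Option Bool) : ℝ := ∑ ω : V → Bool, wt q ω * F (merge σ ω)

omit [Fintype V] in
/-- After a step on unrevealed sites, completing by `ω'` is completing the old state by `mix S x ω'`. -/
theorem merge_stepPA {S : Finset V} {σ : V → Option Bool} (hS : ∀ v ∈ S, σ v = none) (x ω' : V → Bool) :
    merge (stepPA S σ x) ω' = merge σ (mix S x ω') := by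
  funext v
  unfold merge stepPA mix
  by_cases hv : v ∈ S
  · simp [hv, hS v hv]
  · simp [hv]

/-- **Tower identity**: `cval σ = Σ_ω π_q(ω) · cval (step σ ω)` for a step on unrevealed sites. -/
theorem cval_eq_sum_cval_stepPA (q : ℝ) (F : (V → Bool) → ℝ) {S : Finset V} {σ : V → Option Bool}
    (hS : ∀ v ∈ S, σ v = none) :
    cval q F σ = ∑ ω : V → Bool, wt q ω * cval q F (stepPA S σ ω) := by
  unfold cval
  simp_rw [merge_stepPA hS, Finset.mul_sum, ← mul_assoc]
  exact (sum_sum_mix q S (fun ω => F (merge σ ω))).symm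

/-- **Monotonicity of the continuation value in the revealed values**: if `F` is monotone and `x ≤ x'` on
`S`, then `cval (step σ x) ≤ cval (step σ x')`. -/
theorem cval_stepPA_mono {q : ℝ} (hq0 : 0 ≤ q) (hq1 : q ≤ 1) {F : (V → Bool) → ℝ} (hF : Monotone F)
    (S : Finset V) (σ : V → Option Bool) {x x' : V → Bool} (hxx' : ∀ v ∈ S, x v ≤ x' v) :
    cval q F (stepPA S σ x) ≤ cval q F (stepPA S σ x') := by
  unfold cval
  refine Finset.sum_le_sum fun ω _ => mul_le_mul_of_nonneg_left (hF fun v => ?_) (wt_nonneg hq0 hq1 ω)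
  unfold merge stepPA
  by_cases hv : v ∈ S
  · simp only [hv, ↓reduceIte, Option.getD_some]; exact hxx' v hv
  · simp only [hv, ↓reduceIte]; exact le_rfl

/-- The continuation value only reads the reported values on the examined sites. -/
theorem cval_stepPA_congr (q : ℝ) (F : (V → Bool) → ℝ) (S : Finset V) (σ : V → Option Bool)
    {x x' : V → Bool} (hxx' : ∀ v ∈ S, x v = x' v) :
    cval q F (stepPA S σ x) = cval q F (stepPA S σ x') := by
  have : stepPA S σ x = stepPA S σ x' := by
    funext v; unfold stepPA; by_cases hv : v ∈ S <;> simp [hv, hxx' v]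
  rw [this]

/-- At the empty state the continuation value is the plain expectation `E_{π_q}[F]`. -/
theorem cval_empty (q : ℝ) (F : (V → Bool) → ℝ) : cval q F (fun _ => none) = ∑ ω : V → Bool, wt q ω * F ω := by
  unfold cval merge; rfl

/-- If `F` is determined by the revealed sites of `σ`, the continuation value is that determined value. -/
theorem cval_eq_of_determined (q : ℝ) (F : (V → Bool) → ℝ) (σ : V → Option Bool) (ω₀ : V → Bool)
    (h : ∀ ω, F (merge σ ω) = F (merge σ ω₀)) : cval q F σ = F (merge σ ω₀) := by
  unfold cval
  simp_rw [h, ← Finset.sum_mul, sum_wt, one_mul]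

/-! ### The theorem -/

section Process

variable {Ω : Type*} [Fintype Ω]

/-- **Test functions for one step** (a predicate of this file, not a cited fact): monotone in the examined
values and blind to the other coordinates. -/
def StepTest (S : Finset V) (g : (V → Bool) → ℝ) : Prop :=
  (∀ x x' : V → Bool, (∀ v ∈ S, x v ≤ x' v) → g x ≤ g x') ∧
    (∀ x x' : V → Bool, (∀ v ∈ S, x v = x' v) → g x = g x')

/-- **Step-wise domination hypothesis** (a predicate of this file, not a cited fact): at every step `n` and
state `σ`, against every step test function,
the `μ`-law of the reported values on `{run_n = σ}` dominates `π_q`: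
`Σ_{w : run_n w = σ} μ w · g (out w σ) ≥ μ(run_n = σ) · E_{π_q}[g]`. -/
def Dominating (q : ℝ) (R : (V → Option Bool) → Finset V) (μ : Ω → ℝ)
    (out : Ω → (V → Option Bool) → V → Bool) : Prop :=
  ∀ (n : ℕ) (σ : V → Option Bool) (g : (V → Bool) → ℝ), StepTest (R σ) g →
    (∑ w ∈ Finset.univ.filter (fun w => run R (out w) n = σ), μ w) * (∑ ω : V → Bool, wt q ω * g ω) ≤
      ∑ w ∈ Finset.univ.filter (fun w => run R (out w) n = σ), μ w * g (out w σ)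

/-- **One step of the induction**: `Σ_w μ(w) cval(run_n w) ≤ Σ_w μ(w) cval(run_{n+1} w)`. -/
theorem sum_cval_run_le_succ {q : ℝ} (hq0 : 0 ≤ q) (hq1 : q ≤ 1) {F : (V → Bool) → ℝ} (hF : Monotone F)
    (R : (V → Option Bool) → Finset V) (hR : ∀ σ v, v ∈ R σ → σ v = none)
    (μ : Ω → ℝ) (out : Ω → (V → Option Bool) → V → Bool) (hdom : Dominating q R μ out) (n : ℕ) :
    ∑ w, μ w * cval q F (run R (out w) n) ≤ ∑ w, μ w * cval q F (run R (out w) (n + 1)) := by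
  classical
  -- decompose both sums along the fibres of `w ↦ run_n w`
  have key : ∀ σ : V → Option Bool,
      ∑ w ∈ Finset.univ.filter (fun w => run R (out w) n = σ), μ w * cval q F (run R (out w) n) ≤
        ∑ w ∈ Finset.univ.filter (fun w => run R (out w) n = σ), μ w * cval q F (run R (out w) (n + 1)) := by
    intro σ
    have hg : StepTest (R σ) (fun x => cval q F (stepPA (R σ) σ x)) :=
      ⟨fun x x' h => cval_stepPA_mono hq0 hq1 hF (R σ) σ h, fun x x' h => cval_stepPA_congr q F (R σ) σ h⟩
    have h := hdom n σ _ hg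
    calc ∑ w ∈ Finset.univ.filter (fun w => run R (out w) n = σ), μ w * cval q F (run R (out w) n)
        = ∑ w ∈ Finset.univ.filter (fun w => run R (out w) n = σ), μ w * cval q F σ :=
          Finset.sum_congr rfl fun w hw => by rw [(Finset.mem_filter.1 hw).2]
      _ = (∑ w ∈ Finset.univ.filter (fun w => run R (out w) n = σ), μ w) *
            ∑ ω : V → Bool, wt q ω * cval q F (stepPA (R σ) σ ω) := by
          rw [Finset.sum_mul, ← cval_eq_sum_cval_stepPA q F (hR σ)]
      _ ≤ ∑ w ∈ Finset.univ.filter (fun w => run R (out w) n = σ), μ w * cval q F (stepPA (R σ) σ (out w σ)) := h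
      _ = ∑ w ∈ Finset.univ.filter (fun w => run R (out w) n = σ), μ w * cval q F (run R (out w) (n + 1)) :=
          Finset.sum_congr rfl fun w hw => by
            have hw' : run R (out w) n = σ := (Finset.mem_filter.1 hw).2
            simp only [run, hw']
  rw [← Finset.sum_fiberwise_of_maps_to (s := Finset.univ) (t := Finset.univ.image fun w => run R (out w) n)
        (g := fun w => run R (out w) n) (fun w hw => Finset.mem_image_of_mem _ hw),
      ← Finset.sum_fiberwise_of_maps_to (s := Finset.univ) (t := Finset.univ.image fun w => run R (out w) n)
        (g := fun w => run R (out w) n) (f := fun w => μ w * cval q F (run R (out w) (n + 1)))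
        (fun w hw => Finset.mem_image_of_mem _ hw)]
  exact Finset.sum_le_sum fun σ _ => key σ

/-- **Adaptive stochastic domination, finite version** (the coupling-free form of van den Berg–Ermakov's
§3 "global comparison"): under step-wise domination, for a monotone payoff `F` determined after `N`
steps by the revealed sites, `E_{π_q}[F] ≤ Σ_w μ(w) F(final state of w)`. -/
theorem expect_le_of_dominating {q : ℝ} (hq0 : 0 ≤ q) (hq1 : q ≤ 1) {F : (V → Bool) → ℝ} (hF : Monotone F)
    (R : (V → Option Bool) → Finset V) (hR : ∀ σ v, v ∈ R σ → σ v = none)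
    (μ : Ω → ℝ) (hμ : ∑ w, μ w = 1) (out : Ω → (V → Option Bool) → V → Bool) (hdom : Dominating q R μ out)
    (N : ℕ) (ω₀ : V → Bool)
    (hdet : ∀ w ω, F (merge (run R (out w) N) ω) = F (merge (run R (out w) N) ω₀)) :
    ∑ ω : V → Bool, wt q ω * F ω ≤ ∑ w, μ w * F (merge (run R (out w) N) ω₀) := by
  have hmono : ∀ n, ∑ w, μ w * cval q F (run R (out w) 0) ≤ ∑ w, μ w * cval q F (run R (out w) n) := by
    intro n
    induction n with
    | zero => exact le_rfl
    | succ n ih => exact ih.trans (sum_cval_run_le_succ hq0 hq1 hF R hR μ out hdom n)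
  have h0 : ∑ w, μ w * cval q F (run R (out w) 0) = (∑ w, μ w) * ∑ ω : V → Bool, wt q ω * F ω := by
    simp only [run, cval_empty, Finset.sum_mul]
  have hN : ∑ w, μ w * cval q F (run R (out w) N) = ∑ w, μ w * F (merge (run R (out w) N) ω₀) :=
    Finset.sum_congr rfl fun w _ => by rw [cval_eq_of_determined q F _ ω₀ (hdet w)]
  have := hmono N
  rw [h0, hN, hμ, one_mul] at this
  exact this

end Process

end AdaptDom

end Summit.CriticalPhenomena.PercolationContinuityZ3.Theorems.Pcint
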